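import Summits.NavierStokesRegularity.NavierStokesRegularity.Theses.HardyPointSink
import Literature.Analysis.Calculus.ScaledCutoffFamily
import Summits.NavierStokesRegularity.NavierStokesRegularity.Theorems.HardyPointSinkHardyBalanceLawTimeLayer
import Literature.Analysis.PDE.NewtonianPotentialRegularity
import Literature.Analysis.FluidPDE.LerayHopfProofs
import Summits.NavierStokesRegularity.NavierStokesRegularity.Theorems.HardyPointSinkHardyBalanceLawLimits
import Summits.NavierStokesRegularity.NavierStokesRegularity.Theorems.HardyPointSinkHardyBalanceLawCutoffLimits
import HarnessLib

/-!
# Route HardyPointSink — `HardyBalanceLaw` (item stmt-NavierStokesRegularity-8388)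

**The point-sink balance law for the Hardy energy.** For `ν > 0` and a classical solution
`(u, p)` of the unforced Navier–Stokes system, jointly smooth on `[0, T] × ℝ³`, with the
polynomial decay `(1+|x|)² (|u| + |∇u|) + (1+|x|) |uₜ| + |p| ≤ C` uniformly in `t`, for every
centre `x₀` and `0 ≤ t₁ ≤ t₂ ≤ T`:

`∫ |u(t₂)|²/|x-x₀| - ∫ |u(t₁)|²/|x-x₀|
   = -2 ∫_{t₁}^{t₂} ( ν ∫ |∇u(s)|²_F/|x-x₀| + 2πν |u(s,x₀)|²
                      + ∫ (|u|²/2 + p)(s,x) ⟨u(s,x), x-x₀⟩/|x-x₀|³ ) ds`.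

## Proof

Test the local energy identity of the classical solution against the smooth compactly
supported weights `ψₙ(x) = (‖x - x₀‖² + aₙ)^{-1/2} χₙ(x)`, `aₙ = (n+1)⁻²`, `χₙ` a scaled cut-off
equal to `1` on `B̄(x₀, n+1)` (`…TimeLayer`: the identity on the closed interval `[0, T]`,
integrated over `[t₁, t₂]`). At each time the flux converges (`…SliceLimit`): the Laplacian of
the regularised Newtonian weight is minus the Newtonian bump `3aₙ(‖x-x₀‖² + aₙ)^{-5/2}`, an
approximate identity of mass `4π` (`…KernelMass`), which produces the point sink
`4πν|u(s,x₀)|²`; the remaining terms converge by dominated convergence against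
`(1+‖x‖)⁻⁴|x-x₀|⁻¹` and `(1+‖x‖)⁻²|x-x₀|⁻²` (`…Limits`, `…CutoffLimits`, `…Integrability`), with
bounds uniform in the time slice, so dominated convergence in time and in the two boundary
terms gives the identity in the limit `n → ∞`.

## References

* L. Caffarelli, R. Kohn, L. Nirenberg, CPAM 35 (1982), §2 and §8 (Theorems C–D);
  A. J. Majda, A. L. Bertozzi, *Vorticity and Incompressible Flow*, Prop. 1.13;
  D. Gilbarg, N. Trudinger, (2.12) (`Δ(1/r) = -4πδ` in `ℝ³`).
-/

noncomputable section

open MeasureTheory Metric Set Filter Topology TopologicalSpace Function InnerProductSpace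
open Literature.Analysis.PDE Literature.Analysis.FluidPDE
open scoped RealInnerProductSpace Laplacian NNReal Interval ContDiff

set_option linter.dupNamespace false -- nested layout Summit.<S>.<Sub>, Sub = S (D-0017)

namespace Summit.NavierStokesRegularity.NavierStokesRegularity.Theorems

/-- `|t₁ + t₂ + t₃ + t₄ - t₅ + t₆ - t₇| ≤ |t₁| + |t₂| + |t₃| + |t₄| + |t₅| + |t₆| + |t₇|`. -/
theorem hardyPointSink_abs_seven_le (t₁ t₂ t₃ t₄ t₅ t₆ t₇ : ℝ) :
    |t₁ + t₂ + t₃ + t₄ - t₅ + t₆ - t₇| ≤ |t₁| + |t₂| + |t₃| + |t₄| + |t₅| + |t₆| + |t₇| := by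
  rw [abs_le]
  constructor <;> linarith [neg_abs_le t₁, le_abs_self t₁, neg_abs_le t₂, le_abs_self t₂,
    neg_abs_le t₃, le_abs_self t₃, neg_abs_le t₄, le_abs_self t₄, neg_abs_le t₅, le_abs_self t₅,
    neg_abs_le t₆, le_abs_self t₆, neg_abs_le t₇, le_abs_self t₇]

/-- The seven-term bound with the viscosity coefficients. -/
theorem hardyPointSink_seven_bound {ν t₁ t₂ t₃ t₄ t₅ t₆ t₇ b₁ b₂ b₃ b₄ b₅ b₆ b₇ : ℝ}
    (h₁ : |t₁| ≤ b₁) (h₂ : |t₂| ≤ b₂) (h₃ : |t₃| ≤ b₃) (h₄ : |t₄| ≤ b₄) (h₅ : |t₅| ≤ b₅)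
    (h₆ : |t₆| ≤ b₆) (h₇ : |t₇| ≤ b₇) :
    |(-ν) * t₁ + ν * t₂ + (2 * ν) * t₃ + ν * t₄ - t₅ + t₆ - 2 * ν * t₇| ≤
      |ν| * b₁ + |ν| * b₂ + 2 * |ν| * b₃ + |ν| * b₄ + b₅ + b₆ + 2 * |ν| * b₇ := by
  have hν : 0 ≤ |ν| := abs_nonneg ν
  have a₁ : |(-ν) * t₁| ≤ |ν| * b₁ := by
    rw [abs_mul, abs_neg]; exact mul_le_mul_of_nonneg_left h₁ hν
  have a₂ : |ν * t₂| ≤ |ν| * b₂ := by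
    rw [abs_mul]; exact mul_le_mul_of_nonneg_left h₂ hν
  have a₃ : |(2 * ν) * t₃| ≤ 2 * |ν| * b₃ := by
    rw [abs_mul, abs_mul, abs_two]; exact mul_le_mul_of_nonneg_left h₃ (by positivity)
  have a₄ : |ν * t₄| ≤ |ν| * b₄ := by
    rw [abs_mul]; exact mul_le_mul_of_nonneg_left h₄ hν
  have a₇ : |2 * ν * t₇| ≤ 2 * |ν| * b₇ := by
    rw [abs_mul, abs_mul, abs_two]; exact mul_le_mul_of_nonneg_left h₇ (by positivity)
  have key := hardyPointSink_abs_seven_le ((-ν) * t₁) (ν * t₂) ((2 * ν) * t₃) (ν * t₄) t₅ t₆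
    (2 * ν * t₇)
  linarith

/-- Splitting the integral of the six-piece integrand. -/
theorem hardyPointSink_integral_six {f₁ f₂ f₃ f₄ f₅ f₆ : EuclideanSpace ℝ (Fin 3) → ℝ}
    (h₁ : Integrable f₁) (h₂ : Integrable f₂) (h₃ : Integrable f₃) (h₄ : Integrable f₄)
    (h₅ : Integrable f₅) (h₆ : Integrable f₆) (c₁ c₂ c₃ c₄ : ℝ) :
    ∫ x, (c₁ * f₁ x + c₂ * f₂ x + c₃ * f₃ x + c₄ * f₄ x - f₅ x + f₆ x) =
      c₁ * (∫ x, f₁ x) + c₂ * (∫ x, f₂ x) + c₃ * (∫ x, f₃ x) + c₄ * (∫ x, f₄ x) -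
        (∫ x, f₅ x) + ∫ x, f₆ x := by
  have g₁ : Integrable (fun x => c₁ * f₁ x) := h₁.const_mul c₁
  have g₂ : Integrable (fun x => c₂ * f₂ x) := h₂.const_mul c₂
  have g₃ : Integrable (fun x => c₃ * f₃ x) := h₃.const_mul c₃
  have g₄ : Integrable (fun x => c₄ * f₄ x) := h₄.const_mul c₄
  have g₁₂ : Integrable (fun x => c₁ * f₁ x + c₂ * f₂ x) := g₁.add g₂
  have g₁₂₃ : Integrable (fun x => c₁ * f₁ x + c₂ * f₂ x + c₃ * f₃ x) := g₁₂.add g₃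
  have g₁₂₃₄ : Integrable (fun x => c₁ * f₁ x + c₂ * f₂ x + c₃ * f₃ x + c₄ * f₄ x) := g₁₂₃.add g₄
  have g₁₂₃₄₅ : Integrable (fun x => c₁ * f₁ x + c₂ * f₂ x + c₃ * f₃ x + c₄ * f₄ x - f₅ x) :=
    g₁₂₃₄.sub h₅
  rw [integral_add g₁₂₃₄₅ h₆, integral_sub g₁₂₃₄ h₅, integral_add g₁₂₃ g₄, integral_add g₁₂ g₃,
    integral_add g₁ g₂, integral_const_mul, integral_const_mul, integral_const_mul, integral_const_mul]

/-- **The flux at a fixed time converges, with a uniform bound.** See the module docstring; the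
cut-offs enter only through the listed properties (`exists_smooth_cutoff_family` provides them),
and the weights through `hψ`. -/
theorem hardyPointSink_slice_limit (x₀ : EuclideanSpace ℝ (Fin 3)) (ν : ℝ) {C C₁ C₂ : ℝ}
    (hC : 0 ≤ C) {v : EuclideanSpace ℝ (Fin 3) → EuclideanSpace ℝ (Fin 3)} (hv : ContDiff ℝ 1 v)
    {q : EuclideanSpace ℝ (Fin 3) → ℝ} (hq : Continuous q)
    (hvC : ∀ x, ‖v x‖ ≤ C * ((1 + ‖x‖) ^ 2)⁻¹)
    (hDvC : ∀ x, ‖fderiv ℝ v x‖ ≤ C * ((1 + ‖x‖) ^ 2)⁻¹) (hqC : ∀ x, |q x| ≤ C)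
    {χ : ℕ → EuclideanSpace ℝ (Fin 3) → ℝ} (hχs : ∀ n, ContDiff ℝ 2 (χ n))
    (hχ0 : ∀ n x, 0 ≤ χ n x) (hχ1 : ∀ n x, χ n x ≤ 1)
    (hχone : ∀ (n : ℕ) (x : EuclideanSpace ℝ (Fin 3)), dist x x₀ ≤ (n : ℝ) + 1 → χ n x = 1)
    (hχD : ∀ (n : ℕ) (x : EuclideanSpace ℝ (Fin 3)), ‖fderiv ℝ (χ n) x‖ ≤ C₁ / ((n : ℝ) + 1))
    (hχDz : ∀ (n : ℕ) (x : EuclideanSpace ℝ (Fin 3)), dist x x₀ < (n : ℝ) + 1 →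
      fderiv ℝ (χ n) x = 0)
    (hχDz' : ∀ (n : ℕ) (x : EuclideanSpace ℝ (Fin 3)), 2 * ((n : ℝ) + 1) < dist x x₀ →
      fderiv ℝ (χ n) x = 0)
    (hχL : ∀ (n : ℕ) (x : EuclideanSpace ℝ (Fin 3)), |(Δ (χ n)) x| ≤ C₂ / ((n : ℝ) + 1) ^ 2)
    (hχLz : ∀ (n : ℕ) (x : EuclideanSpace ℝ (Fin 3)), dist x x₀ < (n : ℝ) + 1 → (Δ (χ n)) x = 0)
    {ψ : ℕ → EuclideanSpace ℝ (Fin 3) → ℝ}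
    (hψ : ∀ n : ℕ, ψ n = fun y => Newtonian.regKernel ((((n : ℝ) + 1)⁻¹) ^ 2) (y - x₀) * χ n y) :
    Tendsto (fun n : ℕ =>
        (∫ x, (ν * ((Δ (ψ n)) x * ‖v x‖ ^ 2) + fderiv ℝ (ψ n) x (v x) * ‖v x‖ ^ 2 +
          2 * (q x * fderiv ℝ (ψ n) x (v x)))) -
        2 * ν * ∫ x, frobeniusNormSq (fderiv ℝ v x) * ψ n x) atTop
      (𝓝 (-2 * (ν * (∫ x, frobeniusNormSq (fderiv ℝ v x) / ‖x - x₀‖) +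
        2 * Real.pi * ν * ‖v x₀‖ ^ 2 +
        ∫ x, (‖v x‖ ^ 2 / 2 + q x) * ⟪v x, x - x₀⟫ / ‖x - x₀‖ ^ 3))) ∧
    ∀ n : ℕ, |(∫ x, (ν * ((Δ (ψ n)) x * ‖v x‖ ^ 2) + fderiv ℝ (ψ n) x (v x) * ‖v x‖ ^ 2 +
          2 * (q x * fderiv ℝ (ψ n) x (v x)))) -
        2 * ν * ∫ x, frobeniusNormSq (fderiv ℝ v x) * ψ n x| ≤
      |ν| * (4 * Real.pi * C ^ 2) +
      |ν| * (3 * C ^ 2 * ∫ x : EuclideanSpace ℝ (Fin 3), ((1 + ‖x‖) ^ 4)⁻¹) +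
      2 * |ν| * (3 * C₁ * C ^ 2 * ∫ x : EuclideanSpace ℝ (Fin 3), ((1 + ‖x‖) ^ 4)⁻¹) +
      |ν| * (C₂ * C ^ 2 * ∫ x : EuclideanSpace ℝ (Fin 3), ((1 + ‖x‖) ^ 4)⁻¹) +
      C * (C ^ 2 + 2 * C) *
        (∫ x : EuclideanSpace ℝ (Fin 3), ((1 + ‖x‖) ^ 2)⁻¹ * (‖x - x₀‖ ^ 2)⁻¹) +
      2 * C₁ * C * (C ^ 2 + 2 * C) *
        (∫ x : EuclideanSpace ℝ (Fin 3), ((1 + ‖x‖) ^ 2)⁻¹ * (‖x - x₀‖ ^ 2)⁻¹) +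
      2 * |ν| * (3 * C ^ 2 * ∫ x : EuclideanSpace ℝ (Fin 3), ((1 + ‖x‖) ^ 4)⁻¹ * ‖x - x₀‖⁻¹) := by
  -- the scales and the cut-offs
  have ha : ∀ n : ℕ, 0 < (((n : ℝ) + 1)⁻¹) ^ 2 := hardyPointSink_seq_pos
  have hat := hardyPointSink_tendsto_seq
  have hχc : ∀ n, Continuous (χ n) := fun n => (hχs n).continuous
  have hχ1' : ∀ n, ContDiff ℝ 1 (χ n) := fun n => (hχs n).of_le one_le_two
  have hχe := hardyPointSink_eventually_cutoff_eq_one x₀ hχone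
  -- the slice data
  have hGc : Continuous fun x => ‖v x‖ ^ 2 := (hv.continuous.norm).pow 2
  have hGB := hardyPointSink_abs_norm_sq_le hC hvC
  have hG'c : Continuous fun x => frobeniusNormSq (fderiv ℝ v x) :=
    LerayHopfProofs.continuous_frobeniusNormSq.comp (hv.continuous_fderiv one_ne_zero)
  have hG'B := hardyPointSink_abs_frobenius_le hDvC
  have hSc : Continuous fun x => ‖v x‖ ^ 2 + 2 * q x := hGc.add (continuous_const.mul hq)
  have hSB := hardyPointSink_abs_head_le hC hvC hqC
  have hWc : Continuous fun x => ⟪x - x₀, v x⟫ * (‖v x‖ ^ 2 + 2 * q x) :=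
    ((continuous_id.sub continuous_const).inner hv.continuous).mul hSc
  have hWB := hardyPointSink_abs_headFlux_le x₀ hC hvC hqC
  have hvb : ∀ x, ‖v x‖ ≤ C := hardyPointSink_norm_le_of_weighted hC hvC
  have hDvb : ∀ x, ‖fderiv ℝ v x‖ ≤ C := hardyPointSink_norm_le_of_weighted hC hDvC
  -- the seven limits
  obtain ⟨T1, B1, I1⟩ := hardyPointSink_tendsto_sink x₀ (ε := fun n : ℕ => ((n : ℝ) + 1)⁻¹)
    (fun n => by positivity) Newtonian.tendsto_inv_succ_nhdsWithin hv hC hvb hDvb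
  obtain ⟨T2, B2, I2⟩ := hardyPointSink_tendsto_bump_tail x₀ hχc hχ0 hχ1 hχone hGc hGB
  obtain ⟨T3, B3, I3⟩ := hardyPointSink_tendsto_cross_term x₀ hχ1' hχD hχDz hGc hGB
  obtain ⟨T4, B4, I4⟩ := hardyPointSink_tendsto_lap_cutoff_term x₀ hχs hχL hχLz hGc hGB
  obtain ⟨T5, B5, I5⟩ := hardyPointSink_tendsto_flux_term x₀ ha hat hχc hχ0 hχ1 hχe hWc hWB
  obtain ⟨T6, B6, I6⟩ := hardyPointSink_tendsto_grad_cutoff_term x₀ hχ1' hχD hχDz hχDz'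
    hv.continuous hvC hSc hSB
  obtain ⟨T7, B7, I7⟩ := hardyPointSink_tendsto_weight_term x₀ ha hat hχc hχ0 hχ1 hχe hG'c hG'B
  beta_reduce at T1 B1 I1 T2 B2 I2 T3 B3 I3 T4 B4 I4 T5 B5 I5 T6 B6 I6 T7 B7 I7
  -- the flux, split into the six pieces
  have hFlux : ∀ n : ℕ, (∫ x, (ν * ((Δ (ψ n)) x * ‖v x‖ ^ 2) +
      fderiv ℝ (ψ n) x (v x) * ‖v x‖ ^ 2 + 2 * (q x * fderiv ℝ (ψ n) x (v x)))) =
      (-ν) * (∫ x, Newtonian.regBump ((((n : ℝ) + 1)⁻¹) ^ 2) (x - x₀) * ‖v x‖ ^ 2) +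
      ν * (∫ x, Newtonian.regBump ((((n : ℝ) + 1)⁻¹) ^ 2) (x - x₀) * (1 - χ n x) * ‖v x‖ ^ 2) +
      (2 * ν) * (∫ x, (∑ i, fderiv ℝ (fun y : EuclideanSpace ℝ (Fin 3) =>
          Newtonian.regKernel ((((n : ℝ) + 1)⁻¹) ^ 2) (y - x₀)) x
            (stdOrthonormalBasis ℝ (EuclideanSpace ℝ (Fin 3)) i) *
          fderiv ℝ (χ n) x (stdOrthonormalBasis ℝ (EuclideanSpace ℝ (Fin 3)) i)) * ‖v x‖ ^ 2) +
      ν * (∫ x, (Δ (χ n)) x * Newtonian.regKernel ((((n : ℝ) + 1)⁻¹) ^ 2) (x - x₀) * ‖v x‖ ^ 2) -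
      (∫ x, χ n x * (‖x - x₀‖ ^ 2 + (((n : ℝ) + 1)⁻¹) ^ 2) ^ (-3 / 2 : ℝ) *
        (⟪x - x₀, v x⟫ * (‖v x‖ ^ 2 + 2 * q x))) +
      (∫ x, Newtonian.regKernel ((((n : ℝ) + 1)⁻¹) ^ 2) (x - x₀) * fderiv ℝ (χ n) x (v x) *
        (‖v x‖ ^ 2 + 2 * q x)) := by
    intro n
    rw [hψ n]
    rw [integral_congr_ae (Eventually.of_forall fun x =>
      hardyPointSink_flux_integrand_eq x₀ ν (ha n) (hχs n) v q x)]
    exact hardyPointSink_integral_six (I1 n) (I2 n) (I3 n) (I4 n) (I5 n) (I6 n) _ _ _ _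
  have hDis : ∀ n : ℕ, (∫ x, frobeniusNormSq (fderiv ℝ v x) * ψ n x) =
      ∫ x, frobeniusNormSq (fderiv ℝ v x) *
        (Newtonian.regKernel ((((n : ℝ) + 1)⁻¹) ^ 2) (x - x₀) * χ n x) := by
    intro n; rw [hψ n]
  -- the head flux limit in the printed form
  have hLW : (∫ x, ⟪x - x₀, v x⟫ * (‖v x‖ ^ 2 + 2 * q x) / ‖x - x₀‖ ^ 3) =
      2 * ∫ x, (‖v x‖ ^ 2 / 2 + q x) * ⟪v x, x - x₀⟫ / ‖x - x₀‖ ^ 3 := by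
    rw [← integral_const_mul]
    exact integral_congr_ae (Eventually.of_forall fun x => hardyPointSink_headFlux_div_eq x₀ v q x)
  refine ⟨?_, fun n => ?_⟩
  · -- the limit
    have key := ((((((T1.const_mul (-ν)).add (T2.const_mul ν)).add (T3.const_mul (2 * ν))).add
      (T4.const_mul ν)).sub T5).add T6).sub (T7.const_mul (2 * ν))
    rw [hLW] at key
    have e : (fun n : ℕ => (∫ x, (ν * ((Δ (ψ n)) x * ‖v x‖ ^ 2) +
        fderiv ℝ (ψ n) x (v x) * ‖v x‖ ^ 2 + 2 * (q x * fderiv ℝ (ψ n) x (v x)))) -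
        2 * ν * ∫ x, frobeniusNormSq (fderiv ℝ v x) * ψ n x) =
        fun n : ℕ => (-ν) * (∫ x, Newtonian.regBump ((((n : ℝ) + 1)⁻¹) ^ 2) (x - x₀) * ‖v x‖ ^ 2) +
      ν * (∫ x, Newtonian.regBump ((((n : ℝ) + 1)⁻¹) ^ 2) (x - x₀) * (1 - χ n x) * ‖v x‖ ^ 2) +
      (2 * ν) * (∫ x, (∑ i, fderiv ℝ (fun y : EuclideanSpace ℝ (Fin 3) =>
          Newtonian.regKernel ((((n : ℝ) + 1)⁻¹) ^ 2) (y - x₀)) x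
            (stdOrthonormalBasis ℝ (EuclideanSpace ℝ (Fin 3)) i) *
          fderiv ℝ (χ n) x (stdOrthonormalBasis ℝ (EuclideanSpace ℝ (Fin 3)) i)) * ‖v x‖ ^ 2) +
      ν * (∫ x, (Δ (χ n)) x * Newtonian.regKernel ((((n : ℝ) + 1)⁻¹) ^ 2) (x - x₀) * ‖v x‖ ^ 2) -
      (∫ x, χ n x * (‖x - x₀‖ ^ 2 + (((n : ℝ) + 1)⁻¹) ^ 2) ^ (-3 / 2 : ℝ) *
        (⟪x - x₀, v x⟫ * (‖v x‖ ^ 2 + 2 * q x))) +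
      (∫ x, Newtonian.regKernel ((((n : ℝ) + 1)⁻¹) ^ 2) (x - x₀) * fderiv ℝ (χ n) x (v x) *
        (‖v x‖ ^ 2 + 2 * q x)) -
      2 * ν * ∫ x, frobeniusNormSq (fderiv ℝ v x) *
        (Newtonian.regKernel ((((n : ℝ) + 1)⁻¹) ^ 2) (x - x₀) * χ n x) := by
      funext n; rw [hFlux n, hDis n]
    rw [e]
    convert key using 2
    ring
  · -- the uniform bound
    rw [hFlux n, hDis n]
    exact hardyPointSink_seven_bound (B1 n) (B2 n) (B3 n) (B4 n) (B5 n) (B6 n) (B7 n)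

/-! ### The Laplacian against the second iterated derivative, on `ℝ³` -/

/-- `|Δ f(x)| ≤ 3 ‖D²f(x)‖` on `ℝ³`. -/
theorem hardyPointSink_abs_laplacian_le (f : EuclideanSpace ℝ (Fin 3) → ℝ)
    (x : EuclideanSpace ℝ (Fin 3)) :
    |(Δ f) x| ≤ 3 * ‖iteratedFDeriv ℝ 2 f x‖ := by
  set b := EuclideanSpace.basisFun (Fin 3) ℝ with hb
  rw [laplacian_eq_iteratedFDeriv_orthonormalBasis f b]
  have hbn : ∀ i, ‖b i‖ = 1 := fun i => b.orthonormal.1 i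
  have hterm : ∀ i, |iteratedFDeriv ℝ 2 f x ![b i, b i]| ≤ ‖iteratedFDeriv ℝ 2 f x‖ := by
    intro i
    rw [← Real.norm_eq_abs]
    refine (ContinuousMultilinearMap.le_opNorm _ _).trans ?_
    rw [Fin.prod_univ_two, Matrix.cons_val_zero, Matrix.cons_val_one, Matrix.cons_val_fin_one,
      hbn i, mul_one, mul_one]
  calc |∑ i, iteratedFDeriv ℝ 2 f x ![b i, b i]| ≤ ∑ i, |iteratedFDeriv ℝ 2 f x ![b i, b i]| :=
        Finset.abs_sum_le_sum_abs _ _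
    _ ≤ ∑ _i : Fin 3, ‖iteratedFDeriv ℝ 2 f x‖ := Finset.sum_le_sum fun i _ => hterm i
    _ = 3 * ‖iteratedFDeriv ℝ 2 f x‖ := by simp

/-- `Δ f(x) = 0` where `D²f(x) = 0`. -/
theorem hardyPointSink_laplacian_eq_zero_of_iteratedFDeriv {f : EuclideanSpace ℝ (Fin 3) → ℝ}
    {x : EuclideanSpace ℝ (Fin 3)} (h : iteratedFDeriv ℝ 2 f x = 0) : (Δ f) x = 0 := by
  have := hardyPointSink_abs_laplacian_le f x
  rw [h, norm_zero, mul_zero] at this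
  exact abs_nonpos_iff.1 this

/-! ### The decay hypothesis, unpacked -/

/-- From `(1+‖x‖)² (‖u‖ + ‖Du‖) + (1+‖x‖)‖uₜ‖ + |p| ≤ C`: the three bounds used below. -/
theorem hardyPointSink_decay_unpack {a b c d C r : ℝ} (hr : 0 < r) (ha : 0 ≤ a) (hb : 0 ≤ b)
    (hc : 0 ≤ c) (h : r ^ 2 * (a + b) + r * c + |d| ≤ C) :
    a ≤ C * (r ^ 2)⁻¹ ∧ b ≤ C * (r ^ 2)⁻¹ ∧ |d| ≤ C := by
  have hr2 : 0 < r ^ 2 := by positivity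
  have h1 : r ^ 2 * (a + b) ≤ C := by nlinarith [abs_nonneg d]
  have h2 : a + b ≤ C * (r ^ 2)⁻¹ := by
    rw [← div_eq_mul_inv, le_div_iff₀ hr2]; linarith
  refine ⟨by linarith, by linarith, by nlinarith [abs_nonneg d]⟩

/-! ### The item -/

/-- **`HardyBalanceLaw`** (item stmt-NavierStokesRegularity-8388 of route HardyPointSink): the
point-sink balance law `∫|u(t₂)|²/|x-x₀| − ∫|u(t₁)|²/|x-x₀| = −2∫_{t₁}^{t₂}(ν∫|∇u|²/|x-x₀| +
2πν|u(s,x₀)|² + ∫(|u|²/2 + p)⟨u, x-x₀⟩/|x-x₀|³) ds` for classical solutions of the unforced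
Navier–Stokes system on `[0, T] × ℝ³` with the stated polynomial decay. See the module
docstring for the proof. -/
theorem hardyPointSink_hardyBalanceLaw_proof :
    Summit.NavierStokesRegularity.NavierStokesRegularity.Theses.HardyPointSink.HardyBalanceLaw := by
  intro ν T _hν hT u p hsol hdec x₀ t₁ t₂ ht₁ h12 h2T
  obtain ⟨C, hC⟩ := hdec
  -- the decay bounds on `[0, T]`
  have hdec : ∀ t ∈ Icc 0 T, ∀ x : EuclideanSpace ℝ (Fin 3),
      ‖u t x‖ ≤ C * ((1 + ‖x‖) ^ 2)⁻¹ ∧ ‖fderiv ℝ (u t) x‖ ≤ C * ((1 + ‖x‖) ^ 2)⁻¹ ∧ |p t x| ≤ C :=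
    fun t ht x => hardyPointSink_decay_unpack (by positivity) (norm_nonneg _) (norm_nonneg _)
      (norm_nonneg _) (hC t ht x)
  have h0T : (0 : ℝ) ∈ Icc 0 T := ⟨le_rfl, hT.le⟩
  have hCnn : 0 ≤ C := (abs_nonneg _).trans (hdec 0 h0T x₀).2.2
  -- the cut-offs
  obtain ⟨fam, Cf, hCf, hfam⟩ :=
    Literature.Analysis.Calculus.exists_smooth_cutoff_family (E := EuclideanSpace ℝ (Fin 3))
  have hn1 : ∀ n : ℕ, (0 : ℝ) < (n : ℝ) + 1 := fun n => by positivity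
  set χ : ℕ → EuclideanSpace ℝ (Fin 3) → ℝ := fun n => fam x₀ ((n : ℝ) + 1) with hχdef
  have hF := fun n : ℕ => hfam x₀ ((n : ℝ) + 1) (hn1 n)
  have hχsm : ∀ n, ContDiff ℝ ∞ (χ n) := fun n => (hF n).1
  have hχs : ∀ n, ContDiff ℝ 2 (χ n) := fun n => (hχsm n).of_le (by norm_cast)
  have hχ0 : ∀ n x, 0 ≤ χ n x := fun n => (hF n).2.1
  have hχ1 : ∀ n x, χ n x ≤ 1 := fun n => (hF n).2.2.1
  have hχone : ∀ (n : ℕ) (x : EuclideanSpace ℝ (Fin 3)), dist x x₀ ≤ (n : ℝ) + 1 → χ n x = 1 :=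
    fun n => (hF n).2.2.2.1
  have hχcs : ∀ n, HasCompactSupport (χ n) := fun n => (hF n).2.2.2.2.2.2.1
  have hχDz : ∀ (n : ℕ) (x : EuclideanSpace ℝ (Fin 3)), dist x x₀ < (n : ℝ) + 1 →
      fderiv ℝ (χ n) x = 0 := fun n x hx => (hF n).2.2.2.2.2.2.2.2.1 x (Or.inl hx)
  have hχDz' : ∀ (n : ℕ) (x : EuclideanSpace ℝ (Fin 3)), 2 * ((n : ℝ) + 1) < dist x x₀ →
      fderiv ℝ (χ n) x = 0 := fun n x hx => (hF n).2.2.2.2.2.2.2.2.1 x (Or.inr hx)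
  have hχD : ∀ (n : ℕ) (x : EuclideanSpace ℝ (Fin 3)), ‖fderiv ℝ (χ n) x‖ ≤ Cf 1 / ((n : ℝ) + 1) := by
    intro n x
    have h := (hF n).2.2.2.2.2.2.2.2.2 1 x
    rwa [norm_iteratedFDeriv_one, pow_one] at h
  have hχL : ∀ (n : ℕ) (x : EuclideanSpace ℝ (Fin 3)), |(Δ (χ n)) x| ≤ 3 * Cf 2 / ((n : ℝ) + 1) ^ 2 := by
    intro n x
    have h := (hF n).2.2.2.2.2.2.2.2.2 2 x
    calc |(Δ (χ n)) x| ≤ 3 * ‖iteratedFDeriv ℝ 2 (χ n) x‖ := hardyPointSink_abs_laplacian_le _ x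
      _ ≤ 3 * (Cf 2 / ((n : ℝ) + 1) ^ 2) := by gcongr
      _ = 3 * Cf 2 / ((n : ℝ) + 1) ^ 2 := by ring
  have hχLz : ∀ (n : ℕ) (x : EuclideanSpace ℝ (Fin 3)), dist x x₀ < (n : ℝ) + 1 → (Δ (χ n)) x = 0 :=
    fun n x hx => hardyPointSink_laplacian_eq_zero_of_iteratedFDeriv
      ((hF n).2.2.2.2.2.2.2.1 2 (by norm_num) x (Or.inl hx))
  -- the weights
  set ψ : ℕ → EuclideanSpace ℝ (Fin 3) → ℝ := fun n y =>
    Newtonian.regKernel ((((n : ℝ) + 1)⁻¹) ^ 2) (y - x₀) * χ n y with hψdef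
  have hψ : ∀ n : ℕ, ψ n = fun y => Newtonian.regKernel ((((n : ℝ) + 1)⁻¹) ^ 2) (y - x₀) * χ n y :=
    fun n => rfl
  have hψs : ∀ n, ContDiff ℝ ∞ (ψ n) := fun n =>
    (hardyPointSink_contDiff_weight (hardyPointSink_seq_pos n) x₀).mul (hχsm n)
  have hψc : ∀ n, HasCompactSupport (ψ n) := fun n => (hχcs n).mul_left
  have hψcont : ∀ n, Continuous (ψ n) := fun n => (hψs n).continuous
  -- the local energy identity against `ψ n`, integrated over `[t₁, t₂]`
  have hIcc : Icc t₁ t₂ ⊆ Icc 0 T := Icc_subset_Icc ht₁ h2T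
  have hI' : uIcc t₁ t₂ ⊆ Icc 0 T := by rwa [uIcc_of_le h12]
  have hEq : ∀ n : ℕ, (∫ x, ψ n x * ‖u t₂ x‖ ^ 2) - (∫ x, ψ n x * ‖u t₁ x‖ ^ 2) =
      ∫ s in t₁..t₂, ((∫ x, (ν * ((Δ (ψ n)) x * ‖u s x‖ ^ 2) +
        fderiv ℝ (ψ n) x (u s x) * ‖u s x‖ ^ 2 + 2 * (p s x * fderiv ℝ (ψ n) x (u s x)))) -
        2 * ν * ∫ x, frobeniusNormSq (fderiv ℝ (u s) x) * ψ n x) := by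
    intro n
    have hLEI := hardyPointSink_local_energy_identity_Icc hT hsol (hψs n) (hψc n) ht₁ h12 h2T
    have iF := ((hsol.continuousOn_integral_flux_cutoff (hψs n) (hψc n)).mono
      hI').intervalIntegrable (μ := volume)
    have iG := ((hardyPointSink_continuousOn_integral_dissipation_cutoff hT hsol (hψcont n)
      (hψc n)).mono hI').intervalIntegrable (μ := volume)
    rw [intervalIntegral.integral_sub iF (iG.const_mul _), intervalIntegral.integral_const_mul]
    linarith
  -- the slice limit at every time of `[0, T]`
  have hslice := fun s (hs : s ∈ Icc 0 T) =>
    hardyPointSink_slice_limit x₀ ν (C₁ := Cf 1) (C₂ := 3 * Cf 2) hCnn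
      ((hsol.contDiff_velocity hs).of_le (by norm_cast)) (hsol.contDiff_pressure hs).continuous
      (fun x => (hdec s hs x).1) (fun x => (hdec s hs x).2.1) (fun x => (hdec s hs x).2.2)
      hχs hχ0 hχ1 hχone hχD hχDz hχDz' hχL hχLz hψ
  -- dominated convergence in time
  have hRHS : Tendsto (fun n : ℕ => ∫ s in t₁..t₂, ((∫ x, (ν * ((Δ (ψ n)) x * ‖u s x‖ ^ 2) +
        fderiv ℝ (ψ n) x (u s x) * ‖u s x‖ ^ 2 + 2 * (p s x * fderiv ℝ (ψ n) x (u s x)))) -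
        2 * ν * ∫ x, frobeniusNormSq (fderiv ℝ (u s) x) * ψ n x)) atTop
      (𝓝 (∫ s in t₁..t₂, -2 * (ν * (∫ x, frobeniusNormSq (fderiv ℝ (u s) x) / ‖x - x₀‖) +
        2 * Real.pi * ν * ‖u s x₀‖ ^ 2 +
        ∫ x, (‖u s x‖ ^ 2 / 2 + p s x) * ⟪u s x, x - x₀⟫ / ‖x - x₀‖ ^ 3))) := by
    set M : ℝ := |ν| * (4 * Real.pi * C ^ 2) +
      |ν| * (3 * C ^ 2 * ∫ x : EuclideanSpace ℝ (Fin 3), ((1 + ‖x‖) ^ 4)⁻¹) +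
      2 * |ν| * (3 * Cf 1 * C ^ 2 * ∫ x : EuclideanSpace ℝ (Fin 3), ((1 + ‖x‖) ^ 4)⁻¹) +
      |ν| * (3 * Cf 2 * C ^ 2 * ∫ x : EuclideanSpace ℝ (Fin 3), ((1 + ‖x‖) ^ 4)⁻¹) +
      C * (C ^ 2 + 2 * C) *
        (∫ x : EuclideanSpace ℝ (Fin 3), ((1 + ‖x‖) ^ 2)⁻¹ * (‖x - x₀‖ ^ 2)⁻¹) +
      2 * Cf 1 * C * (C ^ 2 + 2 * C) *
        (∫ x : EuclideanSpace ℝ (Fin 3), ((1 + ‖x‖) ^ 2)⁻¹ * (‖x - x₀‖ ^ 2)⁻¹) +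
      2 * |ν| * (3 * C ^ 2 * ∫ x : EuclideanSpace ℝ (Fin 3), ((1 + ‖x‖) ^ 4)⁻¹ * ‖x - x₀‖⁻¹)
      with hM
    have hIoc : Ι t₁ t₂ ⊆ Icc 0 T := by
      rw [uIoc_of_le h12]; exact Ioc_subset_Icc_self.trans hIcc
    refine intervalIntegral.tendsto_integral_filter_of_dominated_convergence (fun _ => M) ?_ ?_
      intervalIntegrable_const ?_
    · refine Eventually.of_forall fun n => ?_
      have c1 := hsol.continuousOn_integral_flux_cutoff (hψs n) (hψc n)
      have c2 := hardyPointSink_continuousOn_integral_dissipation_cutoff hT hsol (hψcont n) (hψc n)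
      exact ((c1.sub (continuousOn_const.mul c2)).mono hIoc).aestronglyMeasurable
        measurableSet_uIoc
    · refine Eventually.of_forall fun n => Eventually.of_forall fun s hs => ?_
      rw [Real.norm_eq_abs]
      exact (hslice s (hIoc hs)).2 n
    · exact Eventually.of_forall fun s hs => (hslice s (hIoc hs)).1
  -- the boundary terms
  have hχc : ∀ n, Continuous (χ n) := fun n => (hχs n).continuous
  have hχe := hardyPointSink_eventually_cutoff_eq_one x₀ hχone
  have hLHS : ∀ t ∈ Icc 0 T, Tendsto (fun n : ℕ => ∫ x, ψ n x * ‖u t x‖ ^ 2) atTop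
      (𝓝 (∫ x, ‖u t x‖ ^ 2 / ‖x - x₀‖)) := by
    intro t ht
    have hGc : Continuous fun x => ‖u t x‖ ^ 2 := ((hsol.contDiff_velocity ht).continuous.norm).pow 2
    have key := (hardyPointSink_tendsto_weight_term x₀ hardyPointSink_seq_pos
      hardyPointSink_tendsto_seq hχc hχ0 hχ1 hχe hGc
      (hardyPointSink_abs_norm_sq_le hCnn fun x => (hdec t ht x).1)).1
    refine key.congr fun n => integral_congr_ae (Eventually.of_forall fun x => ?_)
    simp only [hψ n]
    ring
  have hLHS' : Tendsto (fun n : ℕ => (∫ x, ψ n x * ‖u t₂ x‖ ^ 2) - (∫ x, ψ n x * ‖u t₁ x‖ ^ 2))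
      atTop (𝓝 ((∫ x, ‖u t₂ x‖ ^ 2 / ‖x - x₀‖) - (∫ x, ‖u t₁ x‖ ^ 2 / ‖x - x₀‖))) :=
    (hLHS t₂ ⟨ht₁.trans h12, h2T⟩).sub (hLHS t₁ ⟨ht₁, h12.trans h2T⟩)
  -- conclusion
  have hfin := tendsto_nhds_unique hLHS' (hRHS.congr fun n => (hEq n).symm)
  rw [hfin, intervalIntegral.integral_const_mul]

end Summit.NavierStokesRegularity.NavierStokesRegularity.Theorems

end
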